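import Literature.Computability.Cryptography.ChenQuantumLWEDatumPrior

/-!
# Two secrets at once: the exact two-class law of the datum read-out (T19 — "Lemma D" in the kernel)

REPRODUCTION / ANALYSIS OF A CLAIMED RESULT UNDER ADJUDICATION (withdrawn): Yilei Chen, *Quantum
Algorithms for Lattice Problems*, IACR ePrint 2024/555, version of 2024-04-18 [ChenQuantumLattice2024]
(the version carrying the author's note that Step 9 contains a bug), Step 9 (§3.5.9, pp. 34–38) acting
on `|φ8.b⟩ = Σ_{j ∈ ℤ_P} e(-j²/P) |2D²j·b + v′ mod N⟩` (p. 35), `P = p₁Q`, `N = D²P`.  Bundle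
`papers/QuantumAdvantage/lwe-quantum-autopsy/`, Part 2 (`REPAIR-CENSUS.md` §1 theorem **T19** and §28;
its hand version is §27.4 "Lemma D", written in answer to REFEREE remark R-58.2), on top of
`ChenQuantumLWEDatumPrior.lean` (T15: the exact optimum `priorValue` of the datum read-out under ANY prior
on the secret shifts, attained by the block read-out `datumReadoutPrior`).
HONEST FRAMING: kernel-checked THEOREMS about states occurring in a WITHDRAWN algorithm — the EXACT LAW
of how well ONE measurement of the register Step 9 receives can read the datum Step 9 consumes on the
members of TWO secrets at once (a decidable verdict completing a precise NEGATIVE result, the robust form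
of T18); NOT summit progress, no cryptanalytic claim in either direction, no new algorithm for any
lattice problem; quantum lower bounds are out of scope.

## The question

T18 (`ChenQuantumLWEChirpBasis.lean`) is EXACT: an observer who knows the secret direction reads the
datum with certainty, and no measurement is datum-CERTAIN on the line kets of two directions in different
classes mod `Q`.  Certainty is `ε = 0`; the referee (R-58.2) asked for the ROBUST statement — how close to
certain can one measurement be on two secrets simultaneously?  The census answered by hand (§27.4,
Lemma D) by instantiating T15 at a two-point prior.  This file puts that answer in the kernel, with the
exact optimum and its attainment.

## The model (T10/T13/T15) and the dictionary

The class of one instance: unknown coordinates `U ∌ 0`, a PUBLIC `bk` with `b ≡ bk` off `U` and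
`b ≡ bk ≡ 0 (mod p₁)` on `U`, a unit coordinate of `bk` off `U` (the head), `P` odd (Cond. C.3).  Its
members are `datumKet a (s, c) = QFT|φ8.(b + 2p₁s𝟙_U), v′ + d(a,c)⟩` — secret shift `s` (direction
`b + 2p₁s𝟙_U`, `secretShift`), datum `a ∈ ℤ_Q`, offset shift `c` (`classShift`).  For a POVM `E` on
`ℤ_N^{n+1}` with outcomes in `ℤ_Q` and a secret shift `s`, `P_E(s)` (`secretSuccess`) is the probability
that `E` outputs the datum on a uniformly random member of the SUB-CLASS of `s` (`a`, `c` uniform — they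
are uniform and secret-independent after Steps 1–8, census §24 Lemma A).  For two secret shifts `s₀, s₁`:
`δ = (s₁ − s₀)|_U ∈ ℤ_Q^U` (`secretDiff`; the two directions differ by `2p₁δ` on `U` — the census's
`b′_U = b_U + 2p₁δ`), and `S = #span(δ)`, where `1/S = #ann(δ)/Q = gcd(Q,δ)/Q` (`inv_card_span_eq`) is
also the fraction of blocks `β ∈ ℤ_Q^U` with `⟨β,δ⟩ = 0` (`inv_card_span_eq_card_filter`).  In the
census's letters this file's `Q` is `C = N/p₁` and `p₁Q` is `N`.

## What is proved

* **Value** (`priorValue_pair`): T15's prior value at the two-point prior `𝟙_{s₀} + 𝟙_{s₁}`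
  (`pairPrior`) is EXACTLY `½(1 + 1/S)`.  Mechanism: the twist shifts of the two secrets on the block `β`
  differ by `4⟨β,δ⟩` (`two_mul_twistShift_sub`), `4` is a unit mod the odd `Q`, so the best two-point
  fibre is `2` on the `Q^{#U}/S` blocks annihilating `δ` and `1` elsewhere (`sup_priorFiber_pair`; the
  count is the first isomorphism theorem `card_span_mul_card_ker` of T13).
* **The two-class law** (`secretSuccess_add_le`): for EVERY POVM, `P_E(s₀) + P_E(s₁) ≤ 1 + 1/S`; and
  (`two_class_isGreatest`) the greatest value of `½(P_E(s₀) + P_E(s₁))` over ALL POVMs is EXACTLY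
  `½(1 + 1/S)`, attained by T15's block read-out betting on `s₀` (`secretSuccess_readout_self`,
  `secretSuccess_readout_other`: it scores `1` on `s₀`'s sub-class and exactly `1/S` on `s₁`'s — the
  class-average content of the census's profile F, §27.3, at the level of sub-classes).
* **Robust T18, linear in `ε` and dimension-free** (`secretSuccess_le_of_le`): `P_E(s₀) ≥ 1 − ε` forces
  `P_E(s₁) ≤ 1/S + ε`; (`half_le_eps`) `≥ 1 − ε` on both forces `ε ≥ ½(1 − 1/S)`; and for `δ ≠ 0`
  (`eps_floor`; `minFac Q ≤ S`, `3 ≤ S` since `S > 1` divides the odd `Q`): `ε ≥ ½(1 − 1/minFac Q) ≥ 1/3`.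
  T18's `ε = 0` statement is the limiting case; unlike an overlap (Helstrom) argument from T18's witness
  pair (overlap `~1/P`, informative only for `ε ≲ 1/P²`, census §27.4) the bound does not degrade with
  `P`, `n` or `#U`.
* `Shape.two_class_law`, `Shape.no_two_class_certainty`: the same for every admissible shape.

Reading (census §28, row G7 — verdict UNCHANGED): an instance-aware read-out must commit to ONE secret
class mod `Q` on the unknown coordinates; hedging between two costs at least `½(1 − gcd(Q,δ)/Q) ≥ 1/3`
of the success probability on one of them, whatever the measurement — the exact price is `½(1 − 1/S)`
on average and it is paid optimally by simply betting on one secret.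

## What is NOT here

Priors with more than two points beyond T15's general formula (T15 covers them: `V_μ`); a ROBUST
UNIQUENESS statement (that an `ε`-certain reader of one secret's kets is operator-close to T18's
`datumReader` — census §27.7, not claimed); pairs of arbitrary integer directions outside one census class
(only T18's exact statements); several runs; any algorithm.

References: [ChenQuantumLattice2024] as above; [NielsenChuang2010] §2.2.6 p. 90 (POVMs), Box 2.3 p. 87
(state discrimination); [Korobov1992] Ch. I §1, §3 (character sums, Gauss sums — via T3/T13).
-/

namespace Literature.Computability.Cryptography.Chen2024

open scoped BigOperators ComplexOrder
open Matrix

/-! ### 1. Spans of a non-zero vector in `ℤ_Q^ι`: `minFac Q ≤ #span(δ) ∣ Q` -/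

section SpanFacts

variable (Q : ℕ+) {ι : Type*} [Fintype ι]

/-- `#span(δ) ∣ Q` (Lagrange). [folklore] -/
theorem card_span_dvd (δ : ι → ZQ Q) : Nat.card (span Q δ) ∣ ((Q : ℕ+) : ℕ) := by
  have h : Nat.card (span Q δ) ∣ Nat.card (ZMod ((Q : ℕ+) : ℕ)) :=
    AddSubgroup.card_addSubgroup_dvd_card (span Q δ)
  rwa [Nat.card_zmod] at h

/-- Each generator lies in the span. [folklore] -/
theorem mem_span_self [DecidableEq ι] (δ : ι → ZQ Q) (i : ι) : δ i ∈ span Q δ :=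
  (mem_span_iff Q δ _).2 ⟨Pi.single i 1, by
    rw [Finset.sum_eq_single i (fun j _ hj => by rw [Pi.single_eq_of_ne hj, zero_mul])
      (fun h => absurd (Finset.mem_univ i) h), Pi.single_eq_same, one_mul]⟩

/-- A non-zero vector spans a non-trivial subgroup: `2 ≤ #span(δ)`. [folklore] -/
theorem two_le_card_span [DecidableEq ι] {δ : ι → ZQ Q} (hδ : δ ≠ 0) : 2 ≤ Nat.card (span Q δ) := by
  obtain ⟨i, hi⟩ : ∃ i, δ i ≠ 0 := by
    by_contra h
    push Not at h
    exact hδ (funext h)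
  have hnt : Nontrivial (span Q δ) :=
    ⟨⟨⟨δ i, mem_span_self Q δ i⟩, ⟨0, zero_mem _⟩, fun h => hi (congrArg Subtype.val h)⟩⟩
  exact Finite.one_lt_card_iff_nontrivial.2 hnt

/-- Hence `minFac Q ≤ #span(δ)` for `δ ≠ 0`: `#span(δ) = Q/gcd(Q,δ)` is a divisor `> 1` of `Q`, so
`1/#span(δ) ≤ 1/p_min(Q)` — the census's `gcd(C,δ)/C ≤ 1/p_min(C)`. [folklore] -/
theorem minFac_le_card_span [DecidableEq ι] {δ : ι → ZQ Q} (hδ : δ ≠ 0) :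
    ((Q : ℕ+) : ℕ).minFac ≤ Nat.card (span Q δ) :=
  Nat.minFac_le_of_dvd (two_le_card_span Q hδ) (card_span_dvd Q δ)

/-- For odd `Q` and `δ ≠ 0`: `3 ≤ #span(δ)` (an odd divisor `> 1` of `Q`). [folklore] -/
theorem three_le_card_span [DecidableEq ι] (hQ : Odd ((Q : ℕ+) : ℕ)) {δ : ι → ZQ Q} (hδ : δ ≠ 0) :
    3 ≤ Nat.card (span Q δ) := by
  have h2 := two_le_card_span Q hδ
  obtain ⟨k, hk⟩ : Odd (Nat.card (span Q δ)) := Odd.of_dvd_nat hQ (card_span_dvd Q δ)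
  omega

/-- **Duality as a fraction**: `1/#span(δ) = #ann(δ)/Q` with `ann(δ) = {σ : σδ_i = 0 ∀ i}`
(`#ann(δ) = gcd(Q, δ)`): the census's `gcd(C, δ)/C`. [folklore] -/
theorem inv_card_span_eq [DecidableEq ι] (δ : ι → ZQ Q) :
    ((Nat.card (span Q δ) : ℝ))⁻¹
      = (Nat.card {σ : ZQ Q // ∀ i, σ * δ i = 0} : ℝ) / (((Q : ℕ+) : ℕ) : ℝ) := by
  have hS : (0 : ℝ) < Nat.card (span Q δ) := by exact_mod_cast card_span_pos Q δ
  have hQ : (((Q : ℕ+) : ℕ) : ℝ) ≠ 0 := by exact_mod_cast PNat.ne_zero Q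
  have h : (Nat.card (span Q δ) : ℝ) * (Nat.card {σ : ZQ Q // ∀ i, σ * δ i = 0} : ℝ)
      = (((Q : ℕ+) : ℕ) : ℝ) := by exact_mod_cast card_span_mul_card_ann Q δ
  rw [eq_div_iff hQ, ← h, ← mul_assoc, inv_mul_cancel₀ hS.ne', one_mul]

end SpanFacts

/-! ### 2. The two-point prior, the secret difference, and the sub-class success of a POVM -/

section TwoClass

variable (n : ℕ) (D p₁ Q : ℕ+)

/-- `Q` is odd when `P = p₁Q` is. [folklore] -/
private theorem oddQ (hP : Odd ((p₁ * Q : ℕ+) : ℕ)) : Odd ((Q : ℕ+) : ℕ) := by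
  rw [PNat.mul_coe] at hP
  exact Nat.Odd.of_mul_right hP

/-- The TWO-POINT PRIOR on the secret shifts: unit mass on `s₀` and on `s₁` (an observer told that the
secret is one of two). [folklore] -/
def pairPrior (s₀ s₁ : Fin (n + 1) → ZQ Q) (s : Fin (n + 1) → ZQ Q) : ℝ :=
  (if s = s₀ then 1 else 0) + (if s = s₁ then 1 else 0)

/-- `μ ≥ 0`. [folklore] -/
theorem pairPrior_nonneg (s₀ s₁ s : Fin (n + 1) → ZQ Q) : 0 ≤ pairPrior n Q s₀ s₁ s := by
  unfold pairPrior
  split_ifs <;> norm_num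

/-- Total mass `2` (also when `s₀ = s₁`). [folklore] -/
theorem sum_pairPrior (s₀ s₁ : Fin (n + 1) → ZQ Q) : ∑ s, pairPrior n Q s₀ s₁ s = 2 := by
  unfold pairPrior
  rw [Finset.sum_add_distrib, Finset.sum_ite_eq' Finset.univ s₀, Finset.sum_ite_eq' Finset.univ s₁,
    if_pos (Finset.mem_univ _), if_pos (Finset.mem_univ _)]
  norm_num

/-- `Σ_s μ(s)·f(s) = f(s₀) + f(s₁)`. [folklore] -/
theorem sum_pairPrior_mul (s₀ s₁ : Fin (n + 1) → ZQ Q) (f : (Fin (n + 1) → ZQ Q) → ℂ) :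
    ∑ s, (pairPrior n Q s₀ s₁ s : ℂ) * f s = f s₀ + f s₁ := by
  have h : ∀ s, (pairPrior n Q s₀ s₁ s : ℂ) * f s
      = (if s = s₀ then f s else 0) + (if s = s₁ then f s else 0) := by
    intro s
    unfold pairPrior
    split_ifs <;> push_cast <;> ring
  simp_rw [h]
  rw [Finset.sum_add_distrib, Finset.sum_ite_eq' Finset.univ s₀, Finset.sum_ite_eq' Finset.univ s₁,
    if_pos (Finset.mem_univ _), if_pos (Finset.mem_univ _)]

/-- The two-point-weighted class sums of T15 split into the two sub-classes. [folklore] -/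
theorem sum_pairPrior_weighted (s₀ s₁ : Fin (n + 1) → ZQ Q)
    (f : ZQ Q → (Fin (n + 1) → ZQ Q) × (Fin (n + 1) → ZQ Q) → ℂ) :
    ∑ a : ZQ Q, ∑ sc : (Fin (n + 1) → ZQ Q) × (Fin (n + 1) → ZQ Q), (pairPrior n Q s₀ s₁ sc.1 : ℂ) * f a sc
      = (∑ a : ZQ Q, ∑ c : Fin (n + 1) → ZQ Q, f a (s₀, c))
        + ∑ a : ZQ Q, ∑ c : Fin (n + 1) → ZQ Q, f a (s₁, c) := by
  rw [← Finset.sum_add_distrib]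
  refine Finset.sum_congr rfl fun a _ => ?_
  rw [Fintype.sum_prod_type]
  simp_rw [← Finset.mul_sum]
  exact sum_pairPrior_mul n Q s₀ s₁ _

/-- The DIFFERENCE of two secret shifts on the unknown coordinates, `δ = (s₁ − s₀)|_U ∈ ℤ_Q^U`: the two
directions `b + 2p₁s₀𝟙_U`, `b + 2p₁s₁𝟙_U` of the class differ by `2p₁δ` on `U` (eq. (12)).
[cite: ChenQuantumLattice2024, eq. (12) p. 17] -/
def secretDiff (U : Finset (Fin (n + 1))) (s₀ s₁ : Fin (n + 1) → ZQ Q) : U → ZQ Q :=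
  fun i => s₁ i - s₀ i

/-- `δ = 0` iff the two secret shifts agree on `U` (the two directions coincide). [folklore] -/
theorem secretDiff_eq_zero_iff (U : Finset (Fin (n + 1))) (s₀ s₁ : Fin (n + 1) → ZQ Q) :
    secretDiff n Q U s₀ s₁ = 0 ↔ ∀ i ∈ U, s₁ i = s₀ i := by
  constructor
  · intro h i hi
    have h' := congr_fun h ⟨i, hi⟩
    simpa [secretDiff, sub_eq_zero] using h'
  · intro h
    funext i
    simp [secretDiff, h i i.2]

/-- **The sub-class success of a POVM.**  `P_E(s) = Σ_{a,c} ⟨ψ|E_a|ψ⟩ / Σ_{a,c} ⟨ψ|ψ⟩`,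
`ψ = datumKet a (s, c)`: the probability that `E` outputs the datum when the register holds a uniformly
random member of the sub-class of the secret `b + 2p₁s𝟙_U` (datum `a` and offset shift `c` uniform, as
they are after Steps 1–8). [cite: ChenQuantumLattice2024, §3.5.9 pp. 35–37; NielsenChuang2010, §2.2.6 p. 90] -/
noncomputable def secretSuccess (U : Finset (Fin (n + 1))) (bk b v' : Fin (n + 1) → ℤ)
    (E : POVM (Fin (n + 1) → ZN D p₁ Q) (ZQ Q)) (s : Fin (n + 1) → ZQ Q) : ℝ :=
  (∑ a : ZQ Q, ∑ c : Fin (n + 1) → ZQ Q, E.weight (datumKet n D p₁ Q U bk b v' a (s, c)) a).re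
    / (∑ a : ZQ Q, ∑ c : Fin (n + 1) → ZQ Q,
        (star (datumKet n D p₁ Q U bk b v' a (s, c)) ⬝ᵥ datumKet n D p₁ Q U bk b v' a (s, c))).re

/-- The total weight of one sub-class: `Q·Q^{n+1}·P·N^{n+1}` (flat spectrum of every member, T3).
[cite: ChenQuantumLattice2024, §3.5.9 p. 35] -/
theorem secret_totalWeight (hP : Odd ((p₁ * Q : ℕ+) : ℕ)) (U : Finset (Fin (n + 1)))
    (bk b v' : Fin (n + 1) → ℤ) (s : Fin (n + 1) → ZQ Q) :
    (∑ a : ZQ Q, ∑ c : Fin (n + 1) → ZQ Q,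
        (star (datumKet n D p₁ Q U bk b v' a (s, c)) ⬝ᵥ datumKet n D p₁ Q U bk b v' a (s, c))).re
      = (((Q : ℕ+) : ℕ) : ℝ) * (((Q : ℕ+) : ℕ) : ℝ) ^ (n + 1)
        * ((((p₁ * Q : ℕ+) : ℕ) : ℝ) * (((D * D * (p₁ * Q) : ℕ+) : ℕ) : ℝ) ^ (n + 1)) := by
  have hC : ∀ (a : ZQ Q) (c : Fin (n + 1) → ZQ Q),
      star (datumKet n D p₁ Q U bk b v' a (s, c)) ⬝ᵥ datumKet n D p₁ Q U bk b v' a (s, c)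
        = ((((((p₁ * Q : ℕ+) : ℕ) : ℝ) * (((D * D * (p₁ * Q) : ℕ+) : ℕ) : ℝ) ^ (n + 1) : ℝ)) : ℂ) := by
    intro a c
    rw [datumKet_normSq n D p₁ Q hP]
    push_cast
    ring
  simp_rw [hC, ← Complex.ofReal_sum]
  rw [Complex.ofReal_re, Finset.sum_const, Finset.card_univ, Finset.sum_const, Finset.card_univ,
    Fintype.card_fun, ZMod.card, Fintype.card_fin, nsmul_eq_mul, nsmul_eq_mul]
  push_cast
  ring

/-- At the two-point prior, T15's `μ`-average success of `E` is the mean of its two sub-class successes.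
[folklore] -/
theorem pair_quotient_eq (hP : Odd ((p₁ * Q : ℕ+) : ℕ)) (U : Finset (Fin (n + 1)))
    (bk b v' : Fin (n + 1) → ℤ) (s₀ s₁ : Fin (n + 1) → ZQ Q)
    (E : POVM (Fin (n + 1) → ZN D p₁ Q) (ZQ Q)) :
    (∑ a, ∑ sc, (pairPrior n Q s₀ s₁ sc.1 : ℂ) * E.weight (datumKet n D p₁ Q U bk b v' a sc) a).re
        / (∑ a : ZQ Q, ∑ sc : (Fin (n + 1) → ZQ Q) × (Fin (n + 1) → ZQ Q),
            (pairPrior n Q s₀ s₁ sc.1 : ℂ) * (star (datumKet n D p₁ Q U bk b v' a sc)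
              ⬝ᵥ datumKet n D p₁ Q U bk b v' a sc)).re
      = (secretSuccess n D p₁ Q U bk b v' E s₀ + secretSuccess n D p₁ Q U bk b v' E s₁) / 2 := by
  unfold secretSuccess
  rw [datum_prior_totalWeight n D p₁ Q hP, sum_pairPrior, sum_pairPrior_weighted n Q s₀ s₁,
    Complex.add_re, secret_totalWeight n D p₁ Q hP, secret_totalWeight n D p₁ Q hP]
  ring

/-! ### 3. The value of the two-point prior: `V = ½(1 + 1/#span(δ))` -/

/-- The twist shifts of two secrets differ by `4⟨β, δ⟩`: `2τ(β,s₁) − 2τ(β,s₀) = 4·Σ_{i∈U} β_i δ_i`.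
[cite: ChenQuantumLattice2024, §3.5.9 pp. 35–37, eq. (12) p. 17] -/
theorem two_mul_twistShift_sub (U : Finset (Fin (n + 1))) (bk b : Fin (n + 1) → ℤ) (β : U → ZQ Q)
    (s₀ s₁ : Fin (n + 1) → ZQ Q) :
    2 * twistShift n p₁ Q U bk b β s₁ - 2 * twistShift n p₁ Q U bk b β s₀
      = 4 * ∑ i, β i * secretDiff n Q U s₀ s₁ i := by
  unfold twistShift secretDiff
  rw [Finset.mul_sum, Finset.mul_sum, Finset.mul_sum, ← Finset.sum_sub_distrib]
  refine Finset.sum_congr rfl fun i _ => ?_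
  ring

/-- For odd `P`: the two twist shifts agree on the block `β` iff `⟨β, δ⟩ = 0` (`4` is a unit mod `Q`).
[folklore] -/
theorem twistShift_eq_iff (hP : Odd ((p₁ * Q : ℕ+) : ℕ)) (U : Finset (Fin (n + 1)))
    (bk b : Fin (n + 1) → ℤ) (β : U → ZQ Q) (s₀ s₁ : Fin (n + 1) → ZQ Q) :
    2 * twistShift n p₁ Q U bk b β s₀ = 2 * twistShift n p₁ Q U bk b β s₁
      ↔ ∑ i, β i * secretDiff n Q U s₀ s₁ i = 0 := by
  rw [eq_comm, ← sub_eq_zero, two_mul_twistShift_sub, (isUnit_four_of_odd p₁ Q hP).mul_right_eq_zero]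

/-- The two-point fibres: `F(β, g) = [2τ(β,s₀) = g] + [2τ(β,s₁) = g]`. [folklore] -/
theorem priorFiber_pair (U : Finset (Fin (n + 1))) (bk b : Fin (n + 1) → ℤ)
    (s₀ s₁ : Fin (n + 1) → ZQ Q) (β : U → ZQ Q) (g : ZQ Q) :
    priorFiber n p₁ Q U bk b (pairPrior n Q s₀ s₁) β g
      = (if 2 * twistShift n p₁ Q U bk b β s₀ = g then 1 else 0)
        + (if 2 * twistShift n p₁ Q U bk b β s₁ = g then 1 else 0) := by
  unfold priorFiber pairPrior
  rw [Finset.sum_add_distrib, Finset.sum_ite_eq' _ s₀, Finset.sum_ite_eq' _ s₁]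
  simp only [Finset.mem_filter, Finset.mem_univ, true_and]

/-- On the block `β` the best two-point fibre is `2` if the twist shifts of `s₀, s₁` agree there
(`⟨β,δ⟩ = 0`: the two sub-classes put the SAME twisted ket on the block) and `1` otherwise. [folklore] -/
theorem sup_priorFiber_pair (hP : Odd ((p₁ * Q : ℕ+) : ℕ)) (U : Finset (Fin (n + 1)))
    (bk b : Fin (n + 1) → ℤ) (s₀ s₁ : Fin (n + 1) → ZQ Q) (β : U → ZQ Q) :
    Finset.univ.sup' Finset.univ_nonempty (priorFiber n p₁ Q U bk b (pairPrior n Q s₀ s₁) β)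
      = if ∑ i, β i * secretDiff n Q U s₀ s₁ i = 0 then 2 else 1 := by
  by_cases hE : ∑ i, β i * secretDiff n Q U s₀ s₁ i = 0
  · rw [if_pos hE]
    have hτ : 2 * twistShift n p₁ Q U bk b β s₀ = 2 * twistShift n p₁ Q U bk b β s₁ :=
      (twistShift_eq_iff n p₁ Q hP U bk b β s₀ s₁).2 hE
    refine le_antisymm (Finset.sup'_le _ _ fun g _ => ?_) ?_
    · rw [priorFiber_pair]
      split_ifs <;> norm_num
    · refine le_trans (le_of_eq ?_)
        (Finset.le_sup' _ (Finset.mem_univ (2 * twistShift n p₁ Q U bk b β s₀)))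
      rw [priorFiber_pair, if_pos rfl, ← hτ, if_pos rfl]
      norm_num
  · rw [if_neg hE]
    have hτ : 2 * twistShift n p₁ Q U bk b β s₀ ≠ 2 * twistShift n p₁ Q U bk b β s₁ :=
      fun h => hE ((twistShift_eq_iff n p₁ Q hP U bk b β s₀ s₁).1 h)
    refine le_antisymm (Finset.sup'_le _ _ fun g _ => ?_) ?_
    · rw [priorFiber_pair]
      by_cases h0 : 2 * twistShift n p₁ Q U bk b β s₀ = g
      · rw [if_pos h0, if_neg (fun h1 => hτ (h0.trans h1.symm))]
        norm_num
      · rw [if_neg h0]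
        split_ifs <;> norm_num
    · refine le_trans (le_of_eq ?_)
        (Finset.le_sup' _ (Finset.mem_univ (2 * twistShift n p₁ Q U bk b β s₀)))
      rw [priorFiber_pair, if_pos rfl, if_neg (fun h1 => hτ h1.symm)]
      norm_num

/-- **`1/#span(δ)` is the fraction of blocks annihilating `δ`**: `#{β ∈ ℤ_Q^U : ⟨β,δ⟩ = 0} = Q^{#U}/#span(δ)`
(first isomorphism theorem, T13's `card_span_mul_card_ker`). [folklore] -/
theorem inv_card_span_eq_card_filter (U : Finset (Fin (n + 1))) (δ : U → ZQ Q) :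
    ((Nat.card (span Q δ) : ℝ))⁻¹
      = ((Finset.univ.filter fun β : U → ZQ Q => ∑ i, β i * δ i = 0).card : ℝ)
        / (((Q : ℕ+) : ℕ) : ℝ) ^ U.card := by
  have hQ : (0 : ℝ) < ((Q : ℕ+) : ℕ) := by exact_mod_cast PNat.pos Q
  have hQm : (((Q : ℕ+) : ℕ) : ℝ) ^ U.card ≠ 0 := pow_ne_zero _ hQ.ne'
  have hS : (0 : ℝ) < Nat.card (span Q δ) := by exact_mod_cast card_span_pos Q δ
  have hSK : (Nat.card (span Q δ) : ℝ)
        * ((Finset.univ.filter fun β : U → ZQ Q => ∑ i, β i * δ i = 0).card : ℝ)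
      = (((Q : ℕ+) : ℕ) : ℝ) ^ U.card := by
    have h := card_span_mul_card_ker Q δ
    rw [Fintype.card_coe, Nat.card_eq_fintype_card (α := {c : U → ZQ Q // ∑ i, c i * δ i = 0}),
      Fintype.card_subtype] at h
    exact_mod_cast h
  rw [eq_div_iff hQm, ← hSK, ← mul_assoc, inv_mul_cancel₀ hS.ne', one_mul]

/-- **Lemma D (value): T15 at a two-point prior.**  For odd `P` and ANY two secret shifts `s₀, s₁`, the
prior value of the two-point prior is EXACTLY `V = ½(1 + 1/#span(δ))`, `δ = (s₁ − s₀)|_U`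
(`= ½(1 + gcd(Q,δ)/Q)`; `= 1` iff the directions agree on `U`).
[cite: ChenQuantumLattice2024, §3.5.9 pp. 35–37, eq. (12) p. 17] -/
theorem priorValue_pair (hP : Odd ((p₁ * Q : ℕ+) : ℕ)) (U : Finset (Fin (n + 1)))
    (bk b : Fin (n + 1) → ℤ) (s₀ s₁ : Fin (n + 1) → ZQ Q) :
    priorValue n p₁ Q U bk b (pairPrior n Q s₀ s₁)
      = (1 + ((Nat.card (span Q (secretDiff n Q U s₀ s₁)) : ℝ))⁻¹) / 2 := by
  have hQ : (0 : ℝ) < ((Q : ℕ+) : ℕ) := by exact_mod_cast PNat.pos Q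
  have hQm : (((Q : ℕ+) : ℕ) : ℝ) ^ U.card ≠ 0 := pow_ne_zero _ hQ.ne'
  have hsum : (∑ β : U → ZQ Q, (if ∑ i, β i * secretDiff n Q U s₀ s₁ i = 0 then (2 : ℝ) else 1))
      = (((Q : ℕ+) : ℕ) : ℝ) ^ U.card
        + ((Finset.univ.filter fun β : U → ZQ Q => ∑ i, β i * secretDiff n Q U s₀ s₁ i = 0).card : ℝ) := by
    have h1 : ∀ β : U → ZQ Q, (if ∑ i, β i * secretDiff n Q U s₀ s₁ i = 0 then (2 : ℝ) else 1)
        = 1 + (if ∑ i, β i * secretDiff n Q U s₀ s₁ i = 0 then (1 : ℝ) else 0) := by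
      intro β
      split_ifs <;> norm_num
    simp_rw [h1]
    rw [Finset.sum_add_distrib, Finset.sum_const, Finset.card_univ, Fintype.card_fun, ZMod.card,
      Fintype.card_coe, nsmul_eq_mul, mul_one, Nat.cast_pow, Finset.sum_boole]
  unfold priorValue
  simp_rw [sup_priorFiber_pair n p₁ Q hP U bk b s₀ s₁]
  rw [hsum, sum_pairPrior, inv_card_span_eq_card_filter n Q U (secretDiff n Q U s₀ s₁),
    ← same_add_div hQm]
  ring

/-! ### 4. The two-class law for every POVM, and the robust form of T18 -/

/-- **T19 (the two-class law).**  For odd `P`, `b ≡ bk` off `U`, `b ≡ bk ≡ 0 (mod p₁)` on `U`, a unit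
coordinate of `bk` off `U`: for EVERY POVM on the Step-9 register with outcomes in `ℤ_Q` and ANY two
secret shifts, `P_E(s₀) + P_E(s₁) ≤ 1 + 1/#span(δ)` (`= 1 + gcd(Q,δ)/Q`).
[cite: ChenQuantumLattice2024, §3.5.9 pp. 35–37, eq. (12) p. 17; NielsenChuang2010, §2.2.6 p. 90] -/
theorem secretSuccess_add_le (hP : Odd ((p₁ * Q : ℕ+) : ℕ)) (U : Finset (Fin (n + 1)))
    (bk b v' : Fin (n + 1) → ℤ)
    (hb : ∀ i ∈ U, ((p₁ : ℕ) : ℤ) ∣ b i) (hbkU : ∀ i ∈ U, ((p₁ : ℕ) : ℤ) ∣ bk i)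
    (hbk : ∀ i, i ∉ U → bk i = b i) (hunit : ∃ i₀, i₀ ∉ U ∧ IsUnit ((bk i₀ : ℤ) : ZQ Q))
    (E : POVM (Fin (n + 1) → ZN D p₁ Q) (ZQ Q)) (s₀ s₁ : Fin (n + 1) → ZQ Q) :
    secretSuccess n D p₁ Q U bk b v' E s₀ + secretSuccess n D p₁ Q U bk b v' E s₁
      ≤ 1 + ((Nat.card (span Q (secretDiff n Q U s₀ s₁)) : ℝ))⁻¹ := by
  have hμ : (0 : ℝ) < ∑ s, pairPrior n Q s₀ s₁ s := by rw [sum_pairPrior]; norm_num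
  have h := datum_prior_success_prob_le_value n D p₁ Q hP U bk b v' hb hbkU hbk hunit
    (pairPrior n Q s₀ s₁) hμ E
  rw [pair_quotient_eq n D p₁ Q hP, priorValue_pair n p₁ Q hP] at h
  linarith

/-- **Robust T18 (REFEREE R-58.2): near-certainty on one secret caps the other, linearly in `ε`.**  If a
POVM reads the datum with probability `≥ 1 − ε` on the sub-class of `s₀`, it reads it with probability
`≤ 1/#span(δ) + ε` on the sub-class of `s₁`. [cite: ChenQuantumLattice2024, §3.5.9 pp. 35–37;
NielsenChuang2010, Box 2.3 p. 87] -/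
theorem secretSuccess_le_of_le (hP : Odd ((p₁ * Q : ℕ+) : ℕ)) (U : Finset (Fin (n + 1)))
    (bk b v' : Fin (n + 1) → ℤ)
    (hb : ∀ i ∈ U, ((p₁ : ℕ) : ℤ) ∣ b i) (hbkU : ∀ i ∈ U, ((p₁ : ℕ) : ℤ) ∣ bk i)
    (hbk : ∀ i, i ∉ U → bk i = b i) (hunit : ∃ i₀, i₀ ∉ U ∧ IsUnit ((bk i₀ : ℤ) : ZQ Q))
    (E : POVM (Fin (n + 1) → ZN D p₁ Q) (ZQ Q)) (s₀ s₁ : Fin (n + 1) → ZQ Q) {ε : ℝ}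
    (h₀ : 1 - ε ≤ secretSuccess n D p₁ Q U bk b v' E s₀) :
    secretSuccess n D p₁ Q U bk b v' E s₁ ≤ ((Nat.card (span Q (secretDiff n Q U s₀ s₁)) : ℝ))⁻¹ + ε := by
  have h := secretSuccess_add_le n D p₁ Q hP U bk b v' hb hbkU hbk hunit E s₀ s₁
  linarith

/-- **No measurement is near-certain on two secrets at once**: `≥ 1 − ε` on both sub-classes forces
`ε ≥ ½(1 − 1/#span(δ))` (`= ½(1 − gcd(Q,δ)/Q)`). [cite: ChenQuantumLattice2024, §3.5.9 pp. 35–37;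
NielsenChuang2010, Box 2.3 p. 87] -/
theorem half_le_eps (hP : Odd ((p₁ * Q : ℕ+) : ℕ)) (U : Finset (Fin (n + 1)))
    (bk b v' : Fin (n + 1) → ℤ)
    (hb : ∀ i ∈ U, ((p₁ : ℕ) : ℤ) ∣ b i) (hbkU : ∀ i ∈ U, ((p₁ : ℕ) : ℤ) ∣ bk i)
    (hbk : ∀ i, i ∉ U → bk i = b i) (hunit : ∃ i₀, i₀ ∉ U ∧ IsUnit ((bk i₀ : ℤ) : ZQ Q))
    (E : POVM (Fin (n + 1) → ZN D p₁ Q) (ZQ Q)) (s₀ s₁ : Fin (n + 1) → ZQ Q) {ε : ℝ}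
    (h₀ : 1 - ε ≤ secretSuccess n D p₁ Q U bk b v' E s₀)
    (h₁ : 1 - ε ≤ secretSuccess n D p₁ Q U bk b v' E s₁) :
    (1 - ((Nat.card (span Q (secretDiff n Q U s₀ s₁)) : ℝ))⁻¹) / 2 ≤ ε := by
  have h := secretSuccess_add_le n D p₁ Q hP U bk b v' hb hbkU hbk hunit E s₀ s₁
  linarith

/-- **The universal floor.**  If the two secrets differ on `U` (`δ ≠ 0`), then `#span(δ) ≥ minFac Q ≥ 3`,
so `≥ 1 − ε` on both sub-classes forces `ε ≥ ½(1 − 1/minFac Q) ≥ 1/3` — for every `P`, `n`, `#U`.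
[cite: ChenQuantumLattice2024, §3.5.9 pp. 35–37, Cond. C.3 p. 18; NielsenChuang2010, Box 2.3 p. 87] -/
theorem eps_floor (hP : Odd ((p₁ * Q : ℕ+) : ℕ)) (U : Finset (Fin (n + 1)))
    (bk b v' : Fin (n + 1) → ℤ)
    (hb : ∀ i ∈ U, ((p₁ : ℕ) : ℤ) ∣ b i) (hbkU : ∀ i ∈ U, ((p₁ : ℕ) : ℤ) ∣ bk i)
    (hbk : ∀ i, i ∉ U → bk i = b i) (hunit : ∃ i₀, i₀ ∉ U ∧ IsUnit ((bk i₀ : ℤ) : ZQ Q))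
    (E : POVM (Fin (n + 1) → ZN D p₁ Q) (ZQ Q)) {s₀ s₁ : Fin (n + 1) → ZQ Q}
    (hδ : secretDiff n Q U s₀ s₁ ≠ 0) {ε : ℝ}
    (h₀ : 1 - ε ≤ secretSuccess n D p₁ Q U bk b v' E s₀)
    (h₁ : 1 - ε ≤ secretSuccess n D p₁ Q U bk b v' E s₁) :
    (1 - ((((Q : ℕ+) : ℕ).minFac : ℕ) : ℝ)⁻¹) / 2 ≤ ε ∧ (1 : ℝ) / 3 ≤ ε := by
  have h := half_le_eps n D p₁ Q hP U bk b v' hb hbkU hbk hunit E s₀ s₁ h₀ h₁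
  have hS3 : (3 : ℝ) ≤ Nat.card (span Q (secretDiff n Q U s₀ s₁)) := by
    exact_mod_cast three_le_card_span Q (oddQ p₁ Q hP) hδ
  have hmf : ((((Q : ℕ+) : ℕ).minFac : ℕ) : ℝ) ≤ Nat.card (span Q (secretDiff n Q U s₀ s₁)) := by
    exact_mod_cast minFac_le_card_span Q hδ
  have hmf0 : (0 : ℝ) < ((((Q : ℕ+) : ℕ).minFac : ℕ) : ℝ) := by exact_mod_cast Nat.minFac_pos _
  have hinv1 : ((Nat.card (span Q (secretDiff n Q U s₀ s₁)) : ℝ))⁻¹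
      ≤ (((((Q : ℕ+) : ℕ).minFac : ℕ) : ℝ))⁻¹ := inv_anti₀ hmf0 hmf
  have hinv2 : ((Nat.card (span Q (secretDiff n Q U s₀ s₁)) : ℝ))⁻¹ ≤ 1 / 3 := by
    rw [one_div]
    exact inv_anti₀ (by norm_num) hS3
  constructor <;> linarith

/-! ### 5. Attainment: betting on one secret; the exact two-class optimum -/

/-- **The sub-class successes of T15's block read-out.**  With guess table `ĝ` the block read-out is
right on the sub-class of `s` with probability `#{β : 2τ(β,s) = ĝ(β)}/Q^{#U}` — the fraction of blocks
where the guess hits. [cite: ChenQuantumLattice2024, §3.5.9 pp. 35–37, eq. (12) p. 17] -/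
theorem secretSuccess_readout (hP : Odd ((p₁ * Q : ℕ+) : ℕ)) (U : Finset (Fin (n + 1)))
    (bk b v' : Fin (n + 1) → ℤ)
    (hb : ∀ i ∈ U, ((p₁ : ℕ) : ℤ) ∣ b i) (hbkU : ∀ i ∈ U, ((p₁ : ℕ) : ℤ) ∣ bk i)
    (hbk : ∀ i, i ∉ U → bk i = b i) (hunit : ∃ i₀, i₀ ∉ U ∧ IsUnit ((bk i₀ : ℤ) : ZQ Q))
    (ĝ : (U → ZQ Q) → ZQ Q) (s : Fin (n + 1) → ZQ Q) :
    secretSuccess n D p₁ Q U bk b v' (datumReadoutPrior n D p₁ Q hP U bk v' hunit ĝ) s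
      = ((Finset.univ.filter fun β : U → ZQ Q => 2 * twistShift n p₁ Q U bk b β s = ĝ β).card : ℝ)
        / (((Q : ℕ+) : ℕ) : ℝ) ^ U.card := by
  have hQ : (0 : ℝ) < ((Q : ℕ+) : ℕ) := by exact_mod_cast PNat.pos Q
  have hB : 0 < blockConst n D p₁ Q U := blockConst_pos n D p₁ Q U
  have hC : ∀ (a : ZQ Q) (c : Fin (n + 1) → ZQ Q),
      (datumReadoutPrior n D p₁ Q hP U bk v' hunit ĝ).weight (datumKet n D p₁ Q U bk b v' a (s, c)) a
        = (((blockConst n D p₁ Q U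
            * ((Finset.univ.filter fun β : U → ZQ Q =>
                2 * twistShift n p₁ Q U bk b β s = ĝ β).card : ℝ) : ℝ)) : ℂ) := by
    intro a c
    rw [datumReadoutPrior_weight n D p₁ Q hP U bk b v' hb hbkU hbk hunit ĝ a (s, c)]
    push_cast
    ring
  unfold secretSuccess
  simp_rw [hC, ← Complex.ofReal_sum]
  rw [Complex.ofReal_re, Finset.sum_const, Finset.card_univ, Finset.sum_const, Finset.card_univ,
    Fintype.card_fun, ZMod.card, Fintype.card_fin, nsmul_eq_mul, nsmul_eq_mul,
    secret_totalWeight n D p₁ Q hP, ← blockConst_mul_pow n D p₁ Q U]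
  rw [div_eq_div_iff (mul_pos (mul_pos hQ (pow_pos hQ _)) (mul_pos hB (pow_pos hQ _))).ne'
    (pow_ne_zero _ hQ.ne')]
  push_cast
  ring

/-- **Betting on `s₀` is right on ALL of `s₀`'s sub-class** (guess `ĝ(β) = 2τ(β,s₀)`; T15's
`priorValue_single` as a sub-class statement). [cite: ChenQuantumLattice2024, §3.5.9 pp. 35–37] -/
theorem secretSuccess_readout_self (hP : Odd ((p₁ * Q : ℕ+) : ℕ)) (U : Finset (Fin (n + 1)))
    (bk b v' : Fin (n + 1) → ℤ)
    (hb : ∀ i ∈ U, ((p₁ : ℕ) : ℤ) ∣ b i) (hbkU : ∀ i ∈ U, ((p₁ : ℕ) : ℤ) ∣ bk i)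
    (hbk : ∀ i, i ∉ U → bk i = b i) (hunit : ∃ i₀, i₀ ∉ U ∧ IsUnit ((bk i₀ : ℤ) : ZQ Q))
    (s₀ : Fin (n + 1) → ZQ Q) :
    secretSuccess n D p₁ Q U bk b v'
        (datumReadoutPrior n D p₁ Q hP U bk v' hunit (fun β => 2 * twistShift n p₁ Q U bk b β s₀)) s₀
      = 1 := by
  have hQ : (0 : ℝ) < ((Q : ℕ+) : ℕ) := by exact_mod_cast PNat.pos Q
  rw [secretSuccess_readout n D p₁ Q hP U bk b v' hb hbkU hbk hunit]
  have hall : (Finset.univ.filter fun β : U → ZQ Q =>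
      2 * twistShift n p₁ Q U bk b β s₀ = 2 * twistShift n p₁ Q U bk b β s₀) = Finset.univ :=
    Finset.filter_true_of_mem fun β _ => rfl
  rw [hall, Finset.card_univ, Fintype.card_fun, ZMod.card, Fintype.card_coe, Nat.cast_pow,
    div_self (pow_ne_zero _ hQ.ne')]

/-- **… and right on exactly `1/#span(δ)` of `s₁`'s sub-class** (the blocks annihilating `δ`) — the
class-average number of the census's profile F (§27.3) for the pair. [cite: ChenQuantumLattice2024,
§3.5.9 pp. 35–37, eq. (12) p. 17] -/
theorem secretSuccess_readout_other (hP : Odd ((p₁ * Q : ℕ+) : ℕ)) (U : Finset (Fin (n + 1)))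
    (bk b v' : Fin (n + 1) → ℤ)
    (hb : ∀ i ∈ U, ((p₁ : ℕ) : ℤ) ∣ b i) (hbkU : ∀ i ∈ U, ((p₁ : ℕ) : ℤ) ∣ bk i)
    (hbk : ∀ i, i ∉ U → bk i = b i) (hunit : ∃ i₀, i₀ ∉ U ∧ IsUnit ((bk i₀ : ℤ) : ZQ Q))
    (s₀ s₁ : Fin (n + 1) → ZQ Q) :
    secretSuccess n D p₁ Q U bk b v'
        (datumReadoutPrior n D p₁ Q hP U bk v' hunit (fun β => 2 * twistShift n p₁ Q U bk b β s₀)) s₁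
      = ((Nat.card (span Q (secretDiff n Q U s₀ s₁)) : ℝ))⁻¹ := by
  rw [secretSuccess_readout n D p₁ Q hP U bk b v' hb hbkU hbk hunit]
  have hfilter : (Finset.univ.filter fun β : U → ZQ Q =>
        2 * twistShift n p₁ Q U bk b β s₁ = 2 * twistShift n p₁ Q U bk b β s₀)
      = Finset.univ.filter fun β : U → ZQ Q => ∑ i, β i * secretDiff n Q U s₀ s₁ i = 0 := by
    refine Finset.filter_congr fun β _ => ?_
    rw [eq_comm]
    exact twistShift_eq_iff n p₁ Q hP U bk b β s₀ s₁
  rw [hfilter, inv_card_span_eq_card_filter n Q U (secretDiff n Q U s₀ s₁)]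

/-- **T19: the exact two-class optimum.**  For odd `P`, `b ≡ bk` off `U`, `b ≡ bk ≡ 0 (mod p₁)` on `U`,
a unit coordinate of `bk` off `U`, and ANY two secret shifts `s₀, s₁`: the greatest value, over ALL POVMs
on the Step-9 register, of the mean datum success `½(P_E(s₀) + P_E(s₁))` on the two sub-classes is
EXACTLY `½(1 + 1/#span(δ))` (`= ½(1 + gcd(Q,δ)/Q)`), attained by betting on one secret.
[cite: ChenQuantumLattice2024, §3.5.9 pp. 35–37, eq. (12) p. 17; NielsenChuang2010, §2.2.6 p. 90,
Box 2.3 p. 87] -/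
theorem two_class_isGreatest (hP : Odd ((p₁ * Q : ℕ+) : ℕ)) (U : Finset (Fin (n + 1)))
    (bk b v' : Fin (n + 1) → ℤ)
    (hb : ∀ i ∈ U, ((p₁ : ℕ) : ℤ) ∣ b i) (hbkU : ∀ i ∈ U, ((p₁ : ℕ) : ℤ) ∣ bk i)
    (hbk : ∀ i, i ∉ U → bk i = b i) (hunit : ∃ i₀, i₀ ∉ U ∧ IsUnit ((bk i₀ : ℤ) : ZQ Q))
    (s₀ s₁ : Fin (n + 1) → ZQ Q) :
    IsGreatest (Set.range fun E : POVM (Fin (n + 1) → ZN D p₁ Q) (ZQ Q) =>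
        (secretSuccess n D p₁ Q U bk b v' E s₀ + secretSuccess n D p₁ Q U bk b v' E s₁) / 2)
      ((1 + ((Nat.card (span Q (secretDiff n Q U s₀ s₁)) : ℝ))⁻¹) / 2) := by
  have hμ : (0 : ℝ) < ∑ s, pairPrior n Q s₀ s₁ s := by rw [sum_pairPrior]; norm_num
  obtain ⟨ĝ, hĝ⟩ := datum_prior_success_prob_eq_value n D p₁ Q hP U bk b v' hb hbkU hbk hunit
    (pairPrior n Q s₀ s₁) hμ
  rw [pair_quotient_eq n D p₁ Q hP, priorValue_pair n p₁ Q hP] at hĝ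
  refine ⟨⟨datumReadoutPrior n D p₁ Q hP U bk v' hunit ĝ, hĝ⟩, ?_⟩
  rintro _ ⟨E, rfl⟩
  have h := secretSuccess_add_le n D p₁ Q hP U bk b v' hb hbkU hbk hunit E s₀ s₁
  dsimp only
  linarith

end TwoClass

end Literature.Computability.Cryptography.Chen2024

/-! ### 6. For admissible shapes -/

namespace Literature.Computability.Cryptography.Chen2024.Shape

open scoped BigOperators ComplexOrder
open Matrix

variable (S : Shape)

/-- **T19 for every admissible shape (census §28; REFEREE R-58.2).**  Let `U ∌ 0` be the unknown
coordinates, `bk` any PUBLIC vector agreeing with `S.b` off `U` and `≡ 0 (mod p₁)` on `U`, `v′` any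
representative of the offset class, `s₀, s₁` ANY two secret shifts (directions `S.b + 2p₁s₀𝟙_U`,
`S.b + 2p₁s₁𝟙_U`).  The greatest mean datum success `½(P_E(s₀) + P_E(s₁))` over ALL measurements of the
Step-9 register is EXACTLY `½(1 + 1/#span((s₁ − s₀)|_U))`.
[cite: ChenQuantumLattice2024, §3.5.9 pp. 35–37, eq. (12) p. 17, Cond. C.3 p. 18] -/
theorem two_class_law (h : S.Admissible) (U : Finset (Fin (S.n + 1))) (hU : (0 : Fin (S.n + 1)) ∉ U)
    (bk : Fin (S.n + 1) → ℤ) (hbkU : ∀ i ∈ U, ((S.p₁ : ℕ) : ℤ) ∣ bk i)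
    (hbk : ∀ i, i ∉ U → bk i = S.b i) (v' : Fin (S.n + 1) → ℤ) (s₀ s₁ : Fin (S.n + 1) → ZQ S.Q) :
    IsGreatest (Set.range fun E : POVM (Fin (S.n + 1) → ZN S.D S.p₁ S.Q) (ZQ S.Q) =>
        (secretSuccess S.n S.D S.p₁ S.Q U bk S.b v' E s₀
          + secretSuccess S.n S.D S.p₁ S.Q U bk S.b v' E s₁) / 2)
      ((1 + ((Nat.card (span S.Q (secretDiff S.n S.Q U s₀ s₁)) : ℝ))⁻¹) / 2) :=
  two_class_isGreatest S.n S.D S.p₁ S.Q h.odd_P U bk S.b v' (h.p₁_dvd_of_mem hU) hbkU hbk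
    (h.exists_unit_coord hU hbk) s₀ s₁

/-- **Robust T18 for every admissible shape.**  If ONE measurement reads the datum with probability
`≥ 1 − ε` on the sub-classes of two secrets that differ on `U`, then
`ε ≥ ½(1 − 1/#span(δ)) ≥ ½(1 − 1/minFac Q) ≥ 1/3`. [cite: ChenQuantumLattice2024, §3.5.9 pp. 35–37,
Cond. C.3 p. 18; NielsenChuang2010, Box 2.3 p. 87] -/
theorem no_two_class_certainty (h : S.Admissible) (U : Finset (Fin (S.n + 1)))
    (hU : (0 : Fin (S.n + 1)) ∉ U) (bk : Fin (S.n + 1) → ℤ) (hbkU : ∀ i ∈ U, ((S.p₁ : ℕ) : ℤ) ∣ bk i)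
    (hbk : ∀ i, i ∉ U → bk i = S.b i) (v' : Fin (S.n + 1) → ℤ) {s₀ s₁ : Fin (S.n + 1) → ZQ S.Q}
    (hδ : secretDiff S.n S.Q U s₀ s₁ ≠ 0) (E : POVM (Fin (S.n + 1) → ZN S.D S.p₁ S.Q) (ZQ S.Q))
    {ε : ℝ} (h₀ : 1 - ε ≤ secretSuccess S.n S.D S.p₁ S.Q U bk S.b v' E s₀)
    (h₁ : 1 - ε ≤ secretSuccess S.n S.D S.p₁ S.Q U bk S.b v' E s₁) :
    (1 - ((Nat.card (span S.Q (secretDiff S.n S.Q U s₀ s₁)) : ℝ))⁻¹) / 2 ≤ ε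
      ∧ (1 - ((((S.Q : ℕ+) : ℕ).minFac : ℕ) : ℝ)⁻¹) / 2 ≤ ε ∧ (1 : ℝ) / 3 ≤ ε :=
  ⟨half_le_eps S.n S.D S.p₁ S.Q h.odd_P U bk S.b v' (h.p₁_dvd_of_mem hU) hbkU hbk
      (h.exists_unit_coord hU hbk) E s₀ s₁ h₀ h₁,
    eps_floor S.n S.D S.p₁ S.Q h.odd_P U bk S.b v' (h.p₁_dvd_of_mem hU) hbkU hbk
      (h.exists_unit_coord hU hbk) E hδ h₀ h₁⟩

end Literature.Computability.Cryptography.Chen2024.Shape
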